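import Summits.MatrixMultiplication.OmegaCensus.STPPSmallPatternT1K10OrderLaw69
import Summits.MatrixMultiplication.OmegaCensus.STPPSmallPatternT1K11LowHosts
import Summits.MatrixMultiplication.OmegaCensus.STPPSmallPatternT1K12OrderLaw96
import Summits.MatrixMultiplication.OmegaCensus.STPPSmallPatternT1K13OrderLaw110
import Summits.MatrixMultiplication.OmegaCensus.STPPSmallPatternT1K13LowHosts
import Summits.MatrixMultiplication.OmegaCensus.STPPSmallPatternEvenOrderLift
import Summits.MatrixMultiplication.OmegaCensus.STPPSmallPatternCyclicFatLifts

/-!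
# ω-census, small patterns `(1,2,2)^k` / `(2,2,2)^k`, `k = 10 … 13`: the fat lifts of the FINAL `(2,1,1)^k` thresholds (kernel)

Cell `pub-omega`, ω construction census, seat pub-omega ENG2 (gen 37). HONEST FRAMING (verbatim): lottery ticket; floor =
certified bounds/negative ranges.  Census STRUCTURE bookkeeping (row B5, column `T2`; conjecture C10 (a) LIFT-TIGHT); nothing here bears on `ω`.

The `T1` column moved on 2026-08-29 (ENG2 gen 36) to: law `k = 10` at `69` (`exists_isSTPP_211pow10_of_card_ge_69`), cyclic ray `k = 11`
from `81` (`exists_isSTPP_211pow11_zmod_of_le81`), law `k = 12` at `96` (`exists_isSTPP_211pow12_of_card_ge_96`), law `k = 13` at `110`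
(`exists_isSTPP_211pow13_of_card_ge_110`) with cyclic ray from `108` (`exists_isSTPP_211pow13_zmod_of_le108`).  The tree's lifts
(`exists_isSTPP_122pow_zmod_two_mul_of_211pow`, `exists_isSTPP_122_of_even_card_of_law`, `exists_isSTPP_222_of_four_dvd_card_of_law`) give at once:

* `k = 10`: `(1,2,2)¹⁰ ⊆ ℤ/2n` for `n ≥ 69`; every abelian group of EVEN order `≥ 138` hosts `(1,2,2)¹⁰` (record `≥ 140`); order `≥ 276`
  divisible by `4` hosts `(2,2,2)¹⁰` (record `≥ 280`);
* `k = 11`: `(1,2,2)¹¹ ⊆ ℤ/2n` for `n ≥ 81` (record `n ≥ 82`);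
* `k = 12`: every abelian group of EVEN order `≥ 192` hosts `(1,2,2)¹²` (record `≥ 198`); order `≥ 384` divisible by `4` hosts `(2,2,2)¹²`
  (record `≥ 396`);
* `k = 13`: `(1,2,2)¹³ ⊆ ℤ/2n` for `n ≥ 108`; every abelian group of EVEN order `≥ 220` hosts `(1,2,2)¹³`; order `≥ 440` divisible by `4`
  hosts `(2,2,2)¹³` (first `T2`/`T3` lifts filed at `k = 13`; stpp-3's all-abelian `(1,2,2)¹³` law of record starts at `252`).

References: H. Cohn, R. Kleinberg, B. Szegedy, C. Umans, FOCS 2005 (arXiv:math/0511460), Def. 5.1.  Seat pub-omega ENG2 (gen 37), 2026-08-29.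
-/

open Literature.Computability.AlgebraicComplexity Finset

universe u

namespace Summit.MatrixMultiplication.OmegaCensus

/-! ## `k = 10` (law at `69`) -/

/-- **`(1,2,2)¹⁰ ⊆ ℤ/2n` for every `n ≥ 69`** (fat lift of the cyclic `(2,1,1)¹⁰` ray from `69`). [cite: CohnKleinbergSzegedyUmans2005, Def. 5.1] -/
theorem exists_isSTPP_122pow10_zmod_two_mul_of_le69 (n : ℕ) (hn : 69 ≤ n) :
    ∃ A B C : Fin 10 → Finset (ZMod (2 * n)), IsSTPP A B C ∧ ∀ i, (A i).card = 1 ∧ (B i).card = 2 ∧ (C i).card = 2 :=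
  haveI : NeZero n := ⟨by omega⟩
  exists_isSTPP_122pow_zmod_two_mul_of_211pow (exists_isSTPP_211pow10_zmod_of_le69 n hn)

/-- **Every finite abelian group of even order `≥ 138` hosts `(1,2,2)¹⁰`** (even-order lift of the `(2,1,1)¹⁰` law at `69`).
[cite: CohnKleinbergSzegedyUmans2005, Def. 5.1] -/
theorem exists_isSTPP_122pow10_of_even_card_ge_138 {G : Type u} [AddCommGroup G] [Finite G] (heven : Even (Nat.card G))
    (hG : 138 ≤ Nat.card G) :
    ∃ A B C : Fin 10 → Finset G, IsSTPP A B C ∧ ∀ i, (A i).card = 1 ∧ (B i).card = 2 ∧ (C i).card = 2 :=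
  exists_isSTPP_122_of_even_card_of_law (N := 69) (fun Q _ _ hQ => exists_isSTPP_211pow10_of_card_ge_69 hQ) heven (by omega)

/-- Every finite abelian group of order `≥ 276` divisible by `4` hosts `(2,2,2)¹⁰` (double lift of the `(2,1,1)¹⁰` law at `69`).
[cite: CohnKleinbergSzegedyUmans2005, Def. 5.1] -/
theorem exists_isSTPP_222pow10_of_four_dvd_card_ge_276 {G : Type u} [AddCommGroup G] [Finite G] (h4 : 4 ∣ Nat.card G)
    (hG : 276 ≤ Nat.card G) :
    ∃ A B C : Fin 10 → Finset G, IsSTPP A B C ∧ ∀ i, (A i).card = 2 ∧ (B i).card = 2 ∧ (C i).card = 2 :=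
  exists_isSTPP_222_of_four_dvd_card_of_law (N := 69) (fun Q _ _ hQ => exists_isSTPP_211pow10_of_card_ge_69 hQ) h4 (by omega)

/-! ## `k = 11` (cyclic ray from `81`) -/

/-- **`(1,2,2)¹¹ ⊆ ℤ/2n` for every `n ≥ 81`** (fat lift of the cyclic `(2,1,1)¹¹` ray from `81`). [cite: CohnKleinbergSzegedyUmans2005, Def. 5.1] -/
theorem exists_isSTPP_122pow11_zmod_two_mul_of_le81 (n : ℕ) (hn : 81 ≤ n) :
    ∃ A B C : Fin 11 → Finset (ZMod (2 * n)), IsSTPP A B C ∧ ∀ i, (A i).card = 1 ∧ (B i).card = 2 ∧ (C i).card = 2 :=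
  haveI : NeZero n := ⟨by omega⟩
  exists_isSTPP_122pow_zmod_two_mul_of_211pow (exists_isSTPP_211pow11_zmod_of_le81 n hn)

/-! ## `k = 12` (law at `96`) -/

/-- **Every finite abelian group of even order `≥ 192` hosts `(1,2,2)¹²`** (even-order lift of the `(2,1,1)¹²` law at `96`).
[cite: CohnKleinbergSzegedyUmans2005, Def. 5.1] -/
theorem exists_isSTPP_122pow12_of_even_card_ge_192 {G : Type u} [AddCommGroup G] [Finite G] (heven : Even (Nat.card G))
    (hG : 192 ≤ Nat.card G) :
    ∃ A B C : Fin 12 → Finset G, IsSTPP A B C ∧ ∀ i, (A i).card = 1 ∧ (B i).card = 2 ∧ (C i).card = 2 :=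
  exists_isSTPP_122_of_even_card_of_law (N := 96) (fun Q _ _ hQ => exists_isSTPP_211pow12_of_card_ge_96 hQ) heven (by omega)

/-- Every finite abelian group of order `≥ 384` divisible by `4` hosts `(2,2,2)¹²` (double lift of the `(2,1,1)¹²` law at `96`).
[cite: CohnKleinbergSzegedyUmans2005, Def. 5.1] -/
theorem exists_isSTPP_222pow12_of_four_dvd_card_ge_384 {G : Type u} [AddCommGroup G] [Finite G] (h4 : 4 ∣ Nat.card G)
    (hG : 384 ≤ Nat.card G) :
    ∃ A B C : Fin 12 → Finset G, IsSTPP A B C ∧ ∀ i, (A i).card = 2 ∧ (B i).card = 2 ∧ (C i).card = 2 :=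
  exists_isSTPP_222_of_four_dvd_card_of_law (N := 96) (fun Q _ _ hQ => exists_isSTPP_211pow12_of_card_ge_96 hQ) h4 (by omega)

/-! ## `k = 13` (law at `110`, cyclic ray from `108`) -/

/-- **`(1,2,2)¹³ ⊆ ℤ/2n` for every `n ≥ 108`** (fat lift of the cyclic `(2,1,1)¹³` ray from `108`). [cite: CohnKleinbergSzegedyUmans2005, Def. 5.1] -/
theorem exists_isSTPP_122pow13_zmod_two_mul_of_le108 (n : ℕ) (hn : 108 ≤ n) :
    ∃ A B C : Fin 13 → Finset (ZMod (2 * n)), IsSTPP A B C ∧ ∀ i, (A i).card = 1 ∧ (B i).card = 2 ∧ (C i).card = 2 :=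
  haveI : NeZero n := ⟨by omega⟩
  exists_isSTPP_122pow_zmod_two_mul_of_211pow (exists_isSTPP_211pow13_zmod_of_le108 n hn)

/-- **Every finite abelian group of even order `≥ 220` hosts `(1,2,2)¹³`** (even-order lift of the `(2,1,1)¹³` law at `110`).
[cite: CohnKleinbergSzegedyUmans2005, Def. 5.1] -/
theorem exists_isSTPP_122pow13_of_even_card_ge_220 {G : Type u} [AddCommGroup G] [Finite G] (heven : Even (Nat.card G))
    (hG : 220 ≤ Nat.card G) :
    ∃ A B C : Fin 13 → Finset G, IsSTPP A B C ∧ ∀ i, (A i).card = 1 ∧ (B i).card = 2 ∧ (C i).card = 2 :=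
  exists_isSTPP_122_of_even_card_of_law (N := 110) (fun Q _ _ hQ => exists_isSTPP_211pow13_of_card_ge_110 hQ) heven (by omega)

/-- Every finite abelian group of order `≥ 440` divisible by `4` hosts `(2,2,2)¹³` (double lift of the `(2,1,1)¹³` law at `110`).
[cite: CohnKleinbergSzegedyUmans2005, Def. 5.1] -/
theorem exists_isSTPP_222pow13_of_four_dvd_card_ge_440 {G : Type u} [AddCommGroup G] [Finite G] (h4 : 4 ∣ Nat.card G)
    (hG : 440 ≤ Nat.card G) :
    ∃ A B C : Fin 13 → Finset G, IsSTPP A B C ∧ ∀ i, (A i).card = 2 ∧ (B i).card = 2 ∧ (C i).card = 2 :=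
  exists_isSTPP_222_of_four_dvd_card_of_law (N := 110) (fun Q _ _ hQ => exists_isSTPP_211pow13_of_card_ge_110 hQ) h4 (by omega)

end Summit.MatrixMultiplication.OmegaCensus
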